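import Summits.CriticalPhenomena.Ising3D.IsingColumnFaceL11CensusDistinctCross
import Summits.CriticalPhenomena.Ising3D.IsingColumnFaceL11CensusRadiiTrg

/-!
# The catalogue census of §7.3 as kernel facts, X: the recognition question's width thresholds on the certified
`Δε`-segment — both sides (cell `pub-ising3x`, seat recog-1; paper §1.6 / §7.3)

HONEST FRAMING: lottery ticket; floor = tightest certified 3D Ising CFT bounds; no exact-solution
claim without a proof. Island framing: certified exclusion region at stated derivative order and
assumptions; not a determination of the 3D Ising critical exponents beyond that.

§1.6 and §7.3 print the sentence «a certified `Δε`-interval is guaranteed to contain at most one member of the two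
transcendental tables only when its width is below that minimum separation, `4.4·10⁻¹²` — nine orders of magnitude under
the `10⁻²–10⁻³` widths at which §7 reads the census». The tree so far states the two ingredients separately and pairwise:
`realTables_resolution` (two distinct values of `linFamily 12 ∪ trgFullFamily 17 32` on `[81/64, 2855/2048]` differ by
`≥ dL/distU`), `lin_min_separation_attained` (a `LIN` pair `≤ 45983·10⁻¹⁶` apart) and the sharp covering radii
`lin_meets_subinterval` / `trgFull_meets_subinterval` (`IsingColumnFaceL11CensusRadii*`). This module states the
sentence itself, as statements about closed sub-INTERVALS of the segment, in both directions:

* SINGLING OUT (well-posed widths): **`realTables_interval_subsingleton`** — every closed sub-interval of the segment of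
  length `< dL/distU` (a fortiori of length `< 43966·10⁻¹⁶`, `realTables_interval_ncard_le_one`) contains AT MOST ONE
  value of the two tables; **`realTables_interval_pair`** — some closed sub-interval of length `≤ 45983·10⁻¹⁶` contains
  two (the attained `LIN` pair), so the threshold width lies in `[4.39, 4.60]·10⁻¹²` and is not improvable beyond that
  bracket (**`recognition_width`**, the two facts in one statement); per table: `lin_interval_subsingleton`,
  `trg_interval_subsingleton` (threshold `dT/distU ≥ 53910·10⁻¹⁵`), `trg_interval_pair` (`≤ 59213·10⁻¹⁵`).
* CROWDING (the widths of §7): a packing argument over the sharp covering radii (`packing_of_meets`: `n` pairwise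
  disjoint closed sub-intervals of length `r` fit in an interval of length `> n·r`, each meets the table) gives
  **`lin_centi_interval_ncard`** — every closed sub-interval of the segment of length `≥ 10⁻²` holds at least `783`
  distinct `LIN` values — **`trg_centi_interval_ncard`** (`≥ 295` `TRG` values), **`realTables_centi_interval_ncard`**
  (`≥ 783 + 295 − 16 = 1062` values of the two tables, the `16` being ALL their shared values on the segment,
  `lin_inter_trg_segment_ncard`), and at `10⁻³`: `lin_milli_interval_ncard` (`≥ 78`), `trg_milli_interval_ncard`
  (`≥ 29`), `realTables_milli_interval_ncard` (`≥ 91`). These are WORST-CASE lower bounds from the widest holes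
  (the average densities are an order of magnitude higher: `112660` and `39339` values on a segment of length `0.128`);
  they make «at these widths membership carries no evidential weight» a kernel inequality rather than a remark.
No relation-freeness among `π, e, log 2, ζ(3), ζ(5), G, Γ(¼), Γ(⅓)` is assumed anywhere: everything is decided for this
finite table on this segment by the certified enclosures already landed (no `decide` evaluation in this file). A
statement about the frozen catalogue, NOT about `Δε`; nothing is recognised (§1.6).
lottery ticket; floor = tightest certified 3D Ising CFT bounds; no exact-solution claim without a proof.
-/

namespace Summit.CriticalPhenomena.Ising3D
namespace ColumnFaceL11
open Set Literature.MathematicalPhysics.QuantumFieldTheory.ConformalBootstrap3D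

/-! ### Generic interval lemmas -/

/-- If any two distinct members of `S` in `[lo, hi]` are `≥ δ` apart, a closed sub-interval of `[lo, hi]` of length
`< δ` contains at most one member of `S`. [folklore] -/
theorem interval_subsingleton_of_separated {S : Set ℝ} {lo hi δ : ℝ}
    (hsep : ∀ ⦃x y : ℝ⦄, x ∈ S → y ∈ S → lo ≤ x → x ≤ hi → lo ≤ y → y ≤ hi → x ≠ y → δ ≤ |x - y|)
    {a b : ℝ} (ha : lo ≤ a) (hb : b ≤ hi) (hw : b - a < δ) : (S ∩ Set.Icc a b).Subsingleton := by
  rintro x ⟨hx, hxa, hxb⟩ y ⟨hy, hya, hyb⟩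
  by_contra hne
  have h := hsep hx hy (ha.trans hxa) (hxb.trans hb) (ha.trans hya) (hyb.trans hb) hne
  have hxy : |x - y| ≤ b - a := by
    rw [abs_sub_le_iff]; constructor <;> linarith
  linarith

/-- **Packing.** If every closed sub-interval of `[lo, hi]` of length `≥ r > 0` meets `S`, then a closed sub-interval
`[a, b]` of `[lo, hi]` with `n·r < b − a` contains `n` pairwise distinct members of `S`: the `n` intervals
`[a + i·s, a + i·s + r]`, `s = (b − a − r)/(n − 1)`, are pairwise disjoint (`s > r`) and inside `[a, b]`. [folklore] -/
theorem packing_of_meets {S : Set ℝ} {lo hi r : ℝ} (hr : 0 < r)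
    (hmeet : ∀ a b : ℝ, lo ≤ a → b ≤ hi → r ≤ b - a → ∃ v : ℝ, v ∈ S ∧ a ≤ v ∧ v ≤ b)
    {a b : ℝ} (ha : lo ≤ a) (hb : b ≤ hi) (n : ℕ) (hw : (n : ℝ) * r < b - a) :
    ∃ f : Fin n → ℝ, Function.Injective f ∧ ∀ i, f i ∈ S ∧ a ≤ f i ∧ f i ≤ b := by
  rcases Nat.lt_or_ge n 2 with hn | hn
  · -- n = 0 or n = 1
    interval_cases n
    · exact ⟨Fin.elim0, fun i => i.elim0, fun i => i.elim0⟩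
    · obtain ⟨v, hv, h1, h2⟩ := hmeet a (a + r) ha (by push_cast at hw; linarith) (by linarith)
      refine ⟨fun _ => v, fun i j _ => Subsingleton.elim i j, fun i => ⟨hv, h1, ?_⟩⟩
      push_cast at hw; linarith
  · set s : ℝ := (b - a - r) / ((n : ℝ) - 1) with hs_def
    have hn1 : (0 : ℝ) < (n : ℝ) - 1 := by
      have : (2 : ℝ) ≤ n := by exact_mod_cast hn
      linarith
    have hsr : r < s := by
      rw [hs_def, lt_div_iff₀ hn1]; nlinarith
    have hs0 : 0 ≤ s := (hr.trans hsr).le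
    have htop : ((n : ℝ) - 1) * s = b - a - r := by
      rw [hs_def]; field_simp
    -- each packed interval lies inside `[a, b]` and so inside `[lo, hi]`
    have hin : ∀ i : Fin n, lo ≤ a + (i : ℕ) * s ∧ a + (i : ℕ) * s + r ≤ b := by
      intro i
      have hi1 : ((i : ℕ) : ℝ) ≤ (n : ℝ) - 1 := by
        have : (i : ℕ) + 1 ≤ n := i.isLt
        have : (((i : ℕ) + 1 : ℕ) : ℝ) ≤ n := by exact_mod_cast this
        push_cast at this; linarith
      have h0 : (0 : ℝ) ≤ ((i : ℕ) : ℝ) * s := mul_nonneg (by positivity) hs0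
      refine ⟨by linarith, ?_⟩
      have : ((i : ℕ) : ℝ) * s ≤ ((n : ℝ) - 1) * s := mul_le_mul_of_nonneg_right hi1 hs0
      linarith
    have hmem : ∀ i : Fin n, ∃ v : ℝ, v ∈ S ∧ a + (i : ℕ) * s ≤ v ∧ v ≤ a + (i : ℕ) * s + r := fun i =>
      hmeet _ _ (hin i).1 ((hin i).2.trans hb) (by linarith)
    choose f hf using hmem
    refine ⟨f, ?_, fun i => ⟨(hf i).1, ?_, (hf i).2.2.trans (hin i).2⟩⟩
    · -- disjointness: `i < j ⇒ f i ≤ a + i s + r < a + j s ≤ f j`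
      have hlt : ∀ i j : Fin n, (i : ℕ) < (j : ℕ) → f i < f j := by
        intro i j hij
        have hij' : ((i : ℕ) : ℝ) + 1 ≤ ((j : ℕ) : ℝ) := by exact_mod_cast hij
        have : (((i : ℕ) : ℝ) + 1) * s ≤ ((j : ℕ) : ℝ) * s := mul_le_mul_of_nonneg_right hij' hs0
        linarith [(hf i).2.2, (hf j).2.1]
      intro i j hfij
      by_contra hne
      rcases lt_or_gt_of_ne (fun h => hne (Fin.ext h)) with h | h
      · exact absurd hfij (hlt i j h).ne
      · exact absurd hfij (hlt j i h).ne'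
    · have h0 : (0 : ℝ) ≤ ((i : ℕ) : ℝ) * s := mul_nonneg (by positivity) hs0
      linarith [(hf i).2.1]

/-- From `n` pairwise distinct members inside a finite set: its `ncard` is at least `n`. [folklore] -/
theorem le_ncard_of_injective {T : Set ℝ} (hT : T.Finite) {n : ℕ} (f : Fin n → ℝ) (hf : Function.Injective f)
    (hmem : ∀ i, f i ∈ T) : n ≤ T.ncard := by
  classical
  have hsub : (↑(Finset.univ.image f) : Set ℝ) ⊆ T := by
    intro x hx
    simp only [Finset.coe_image, Finset.coe_univ, Set.image_univ, Set.mem_range] at hx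
    obtain ⟨i, rfl⟩ := hx
    exact hmem i
  have h := Set.ncard_le_ncard hsub hT
  rwa [Set.ncard_coe_finset, Finset.card_image_of_injective _ hf, Finset.card_univ, Fintype.card_fin] at h

/-! ### Finiteness of the two tables on the segment (from the landed counts) -/

/-- `linFamily 12` is finite on the certified segment (it has `112660` values there). [folklore] -/
theorem lin_segment_finite : (linFamily 12 ∩ Set.Icc (81 / 64 : ℝ) (2855 / 2048)).Finite :=
  Set.finite_of_ncard_ne_zero (by rw [lin_values_segment_ncard]; norm_num)

/-- `trgFullFamily 17 32` is finite on the certified segment (it has `39339` values there). [folklore] -/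
theorem trg_segment_finite : (trgFullFamily 17 32 ∩ Set.Icc (81 / 64 : ℝ) (2855 / 2048)).Finite :=
  Set.finite_of_ncard_ne_zero (by rw [trg_values_segment_ncard]; norm_num)

/-- The union of the two tables is finite on the certified segment (`151983` values). [folklore] -/
theorem realTables_segment_finite :
    ((linFamily 12 ∪ trgFullFamily 17 32) ∩ Set.Icc (81 / 64 : ℝ) (2855 / 2048)).Finite :=
  Set.finite_of_ncard_ne_zero (by rw [realTables_values_ncard]; norm_num)

/-- Restricting to a sub-interval of the segment keeps a table finite. [folklore] -/
theorem inter_Icc_finite_of_segment {F : Set ℝ} (hF : (F ∩ Set.Icc (81 / 64 : ℝ) (2855 / 2048)).Finite)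
    {a b : ℝ} (ha : (81 / 64 : ℝ) ≤ a) (hb : b ≤ 2855 / 2048) : (F ∩ Set.Icc a b).Finite :=
  hF.subset (Set.inter_subset_inter_right _ (Set.Icc_subset_Icc ha hb))

/-! ### Singling out: below the minimum separation an interval holds at most one value -/

/-- **`LIN`, well-posed widths**: a closed sub-interval of the segment of length `< dL/distU` contains at most one value
of `linFamily 12`. [folklore] -/
theorem lin_interval_subsingleton {a b : ℝ} (ha : (81 / 64 : ℝ) ≤ a) (hb : b ≤ 2855 / 2048)
    (hw : b - a < (dL : ℝ) / distU) : (linFamily 12 ∩ Set.Icc a b).Subsingleton :=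
  interval_subsingleton_of_separated (fun _ _ hx hy h1 h2 h3 h4 hne => lin_min_separation hx hy h1 h2 h3 h4 hne)
    ha hb hw

/-- **`TRG`, well-posed widths**: a closed sub-interval of the segment of length `< dT/distU` (`≥ 53910·10⁻¹⁵`)
contains at most one value of `trgFullFamily 17 32`. [folklore] -/
theorem trg_interval_subsingleton {a b : ℝ} (ha : (81 / 64 : ℝ) ≤ a) (hb : b ≤ 2855 / 2048)
    (hw : b - a < (dT : ℝ) / distU) : (trgFullFamily 17 32 ∩ Set.Icc a b).Subsingleton :=
  interval_subsingleton_of_separated (fun _ _ hx hy h1 h2 h3 h4 hne => trg_min_separation hx hy h1 h2 h3 h4 hne)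
    ha hb hw

/-- **The two transcendental tables, well-posed widths**: a closed sub-interval of `[81/64, 2855/2048]` of length
`< dL/distU = 4.3966…·10⁻¹²` contains AT MOST ONE value of `linFamily 12 ∪ trgFullFamily 17 32` — below that width a
certified `Δε`-interval singles out at most one member of the two tables. [folklore] -/
theorem realTables_interval_subsingleton {a b : ℝ} (ha : (81 / 64 : ℝ) ≤ a) (hb : b ≤ 2855 / 2048)
    (hw : b - a < (dL : ℝ) / distU) : ((linFamily 12 ∪ trgFullFamily 17 32) ∩ Set.Icc a b).Subsingleton :=
  interval_subsingleton_of_separated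
    (fun _ _ hx hy h1 h2 h3 h4 hne => realTables_resolution hx hy h1 h2 h3 h4 hne) ha hb hw

/-- The decimal threshold is below the exact one: `43966·10⁻¹⁶ ≤ dL/distU`. [folklore] -/
theorem decimal_le_dL_div : (43966 : ℝ) / 10 ^ 16 ≤ (dL : ℝ) / distU := by
  rw [div_le_div_iff₀ (by norm_num) distU_pos.1]
  unfold dL distU linS lcm32; norm_num

/-- Decimal form, as a count: a closed sub-interval of the segment of length `< 43966·10⁻¹⁶` holds at most one value of
the two tables. [folklore] -/
theorem realTables_interval_ncard_le_one {a b : ℝ} (ha : (81 / 64 : ℝ) ≤ a) (hb : b ≤ 2855 / 2048)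
    (hw : b - a < (43966 : ℝ) / 10 ^ 16) : ((linFamily 12 ∪ trgFullFamily 17 32) ∩ Set.Icc a b).ncard ≤ 1 := by
  have hs := realTables_interval_subsingleton ha hb (hw.trans_le decimal_le_dL_div)
  haveI : Finite ↥((linFamily 12 ∪ trgFullFamily 17 32) ∩ Set.Icc a b) :=
    (inter_Icc_finite_of_segment realTables_segment_finite ha hb).to_subtype
  exact Set.ncard_le_one_iff_subsingleton.mpr hs

/-! ### Sharpness: an interval of length `≤ 45983·10⁻¹⁶` holding two values -/

/-- **`LIN`, sharpness**: the closed interval between the attained pair `(175 − 5π³ − 11ζ(3))/5 < (48 − 11π + 3G)/12`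
is a sub-interval of the segment of length `≤ 45983·10⁻¹⁶` holding two distinct `LIN` values. [folklore] -/
theorem lin_interval_pair :
    ∃ a b : ℝ, (81 / 64 : ℝ) ≤ a ∧ b ≤ 2855 / 2048 ∧ b - a ≤ (45983 : ℝ) / 10 ^ 16 ∧
      (linFamily 12 ∩ Set.Icc a b).Nontrivial := by
  obtain ⟨hX, hY, h1, h2, hlt, hd⟩ := lin_min_separation_attained
  exact ⟨_, _, h1, h2, hd, lin7TupleVal linSepX, ⟨hX, le_rfl, hlt.le⟩, lin7TupleVal linSepY,
    ⟨hY, hlt.le, le_rfl⟩, hlt.ne⟩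

/-- **`TRG`, sharpness**: a closed sub-interval of the segment of length `≤ 59213·10⁻¹⁵` holding two distinct `TRG`
values (the attained pair `(28/9)·π^(−5/2)·Γ(⅓)² < (3/29)·π³/(Γ(¼) log 2)`). [folklore] -/
theorem trg_interval_pair :
    ∃ a b : ℝ, (81 / 64 : ℝ) ≤ a ∧ b ≤ 2855 / 2048 ∧ b - a ≤ (59213 : ℝ) / 10 ^ 15 ∧
      (trgFullFamily 17 32 ∩ Set.Icc a b).Nontrivial := by
  obtain ⟨hX, hY, h1, h2, hlt, hd⟩ := trg_min_separation_attained
  exact ⟨_, _, h1, h2, hd, trgGTupleVal trgSepX, ⟨hX, le_rfl, hlt.le⟩, trgGTupleVal trgSepY,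
    ⟨hY, hlt.le, le_rfl⟩, hlt.ne⟩

/-- **The two tables, sharpness**: some closed sub-interval of the segment of length `≤ 45983·10⁻¹⁶` holds two distinct
values of `linFamily 12 ∪ trgFullFamily 17 32` (as a count: `2 ≤ ncard`). [folklore] -/
theorem realTables_interval_pair :
    ∃ a b : ℝ, (81 / 64 : ℝ) ≤ a ∧ b ≤ 2855 / 2048 ∧ b - a ≤ (45983 : ℝ) / 10 ^ 16 ∧
      2 ≤ ((linFamily 12 ∪ trgFullFamily 17 32) ∩ Set.Icc a b).ncard := by
  obtain ⟨a, b, ha, hb, hd, hnt⟩ := lin_interval_pair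
  refine ⟨a, b, ha, hb, hd, ?_⟩
  have hfin := inter_Icc_finite_of_segment realTables_segment_finite ha hb
  have hnt' : ((linFamily 12 ∪ trgFullFamily 17 32) ∩ Set.Icc a b).Nontrivial :=
    hnt.mono (Set.inter_subset_inter_left _ Set.subset_union_left)
  exact (Set.one_lt_ncard_iff_nontrivial_and_finite.mpr ⟨hnt', hfin⟩)

/-- **The recognition width of the two transcendental tables on the certified segment, in one statement.** (i) Every
closed sub-interval of `[81/64, 2855/2048]` of length `< 43966·10⁻¹⁶` holds at most one value of
`linFamily 12 ∪ trgFullFamily 17 32`; (ii) some closed sub-interval of length `≤ 45983·10⁻¹⁶` holds two. So «a certified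
`Δε`-interval is guaranteed to contain at most one member of these tables» holds exactly for widths below a threshold
lying in `[4.39, 4.60]·10⁻¹²` (bracket width = the landed `ζ(3)` enclosure). [folklore] -/
theorem recognition_width :
    (∀ a b : ℝ, (81 / 64 : ℝ) ≤ a → b ≤ 2855 / 2048 → b - a < (43966 : ℝ) / 10 ^ 16 →
        ((linFamily 12 ∪ trgFullFamily 17 32) ∩ Set.Icc a b).ncard ≤ 1) ∧
      (∃ a b : ℝ, (81 / 64 : ℝ) ≤ a ∧ b ≤ 2855 / 2048 ∧ b - a ≤ (45983 : ℝ) / 10 ^ 16 ∧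
        2 ≤ ((linFamily 12 ∪ trgFullFamily 17 32) ∩ Set.Icc a b).ncard) :=
  ⟨fun _ _ ha hb hw => realTables_interval_ncard_le_one ha hb hw, realTables_interval_pair⟩

/-! ### Crowding: at the widths of §7 every interval holds hundreds of values (packing over the sharp radii) -/

/-- **`LIN` at `10⁻²`**: every closed sub-interval of the segment of length `≥ 1/100` holds at least `783` distinct
values of `linFamily 12` (`783·r < 1/100 < 784·r` for the sharp covering radius `r = 127623829656·10⁻¹⁶` of
`lin_meets_subinterval`; worst case over the segment — the average is `≈ 8 800`). [folklore] -/
theorem lin_centi_interval_ncard {a b : ℝ} (ha : (81 / 64 : ℝ) ≤ a) (hb : b ≤ 2855 / 2048)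
    (hab : (1 / 100 : ℝ) ≤ b - a) : 783 ≤ (linFamily 12 ∩ Set.Icc a b).ncard := by
  obtain ⟨f, hf, hmem⟩ := packing_of_meets (S := linFamily 12) (by norm_num) lin_meets_subinterval ha hb 783
    (by norm_num at hab ⊢; linarith)
  exact le_ncard_of_injective (inter_Icc_finite_of_segment lin_segment_finite ha hb) f hf
    (fun i => ⟨(hmem i).1, (hmem i).2.1, (hmem i).2.2⟩)

/-- **`LIN` at `10⁻³`**: every closed sub-interval of the segment of length `≥ 1/1000` holds at least `78` distinct
values of `linFamily 12`. [folklore] -/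
theorem lin_milli_interval_ncard {a b : ℝ} (ha : (81 / 64 : ℝ) ≤ a) (hb : b ≤ 2855 / 2048)
    (hab : (1 / 1000 : ℝ) ≤ b - a) : 78 ≤ (linFamily 12 ∩ Set.Icc a b).ncard := by
  obtain ⟨f, hf, hmem⟩ := packing_of_meets (S := linFamily 12) (by norm_num) lin_meets_subinterval ha hb 78
    (by norm_num at hab ⊢; linarith)
  exact le_ncard_of_injective (inter_Icc_finite_of_segment lin_segment_finite ha hb) f hf
    (fun i => ⟨(hmem i).1, (hmem i).2.1, (hmem i).2.2⟩)

/-- **`TRG` at `10⁻²`**: every closed sub-interval of the segment of length `≥ 1/100` holds at least `295` distinct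
values of `trgFullFamily 17 32` (`295·r < 1/100 < 296·r`, `r = 33810750081·10⁻¹⁵` of `trgFull_meets_subinterval`;
average `≈ 3 000`). [folklore] -/
theorem trg_centi_interval_ncard {a b : ℝ} (ha : (81 / 64 : ℝ) ≤ a) (hb : b ≤ 2855 / 2048)
    (hab : (1 / 100 : ℝ) ≤ b - a) : 295 ≤ (trgFullFamily 17 32 ∩ Set.Icc a b).ncard := by
  obtain ⟨f, hf, hmem⟩ := packing_of_meets (S := trgFullFamily 17 32) (by norm_num) trgFull_meets_subinterval ha hb
    295 (by norm_num at hab ⊢; linarith)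
  exact le_ncard_of_injective (inter_Icc_finite_of_segment trg_segment_finite ha hb) f hf
    (fun i => ⟨(hmem i).1, (hmem i).2.1, (hmem i).2.2⟩)

/-- **`TRG` at `10⁻³`**: every closed sub-interval of the segment of length `≥ 1/1000` holds at least `29` distinct
values of `trgFullFamily 17 32`. [folklore] -/
theorem trg_milli_interval_ncard {a b : ℝ} (ha : (81 / 64 : ℝ) ≤ a) (hb : b ≤ 2855 / 2048)
    (hab : (1 / 1000 : ℝ) ≤ b - a) : 29 ≤ (trgFullFamily 17 32 ∩ Set.Icc a b).ncard := by
  obtain ⟨f, hf, hmem⟩ := packing_of_meets (S := trgFullFamily 17 32) (by norm_num) trgFull_meets_subinterval ha hb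
    29 (by norm_num at hab ⊢; linarith)
  exact le_ncard_of_injective (inter_Icc_finite_of_segment trg_segment_finite ha hb) f hf
    (fun i => ⟨(hmem i).1, (hmem i).2.1, (hmem i).2.2⟩)

/-- Inclusion–exclusion on a sub-interval of the segment: the two tables share at most their `16` segment values there,
so `|LIN ∪ TRG| ≥ |LIN| + |TRG| − 16` on every closed sub-interval. [folklore] -/
theorem realTables_interval_ncard_ge {a b : ℝ} (ha : (81 / 64 : ℝ) ≤ a) (hb : b ≤ 2855 / 2048) :
    (linFamily 12 ∩ Set.Icc a b).ncard + (trgFullFamily 17 32 ∩ Set.Icc a b).ncard ≤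
      ((linFamily 12 ∪ trgFullFamily 17 32) ∩ Set.Icc a b).ncard + 16 := by
  set I := Set.Icc a b with hI
  have hAf := inter_Icc_finite_of_segment lin_segment_finite ha hb
  have hBf := inter_Icc_finite_of_segment trg_segment_finite ha hb
  have hu := Set.ncard_union_add_ncard_inter (linFamily 12 ∩ I) (trgFullFamily 17 32 ∩ I) hAf hBf
  have e1 : linFamily 12 ∩ I ∪ trgFullFamily 17 32 ∩ I = (linFamily 12 ∪ trgFullFamily 17 32) ∩ I := by
    rw [Set.union_inter_distrib_right]
  have e2 : linFamily 12 ∩ I ∩ (trgFullFamily 17 32 ∩ I) = linFamily 12 ∩ trgFullFamily 17 32 ∩ I := by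
    ext x; simp only [Set.mem_inter_iff]; tauto
  rw [e1, e2] at hu
  have h16 : (linFamily 12 ∩ trgFullFamily 17 32 ∩ I).ncard ≤ 16 := by
    rw [← lin_inter_trg_segment_ncard]
    refine Set.ncard_le_ncard (Set.inter_subset_inter_right _ (Set.Icc_subset_Icc ha hb)) ?_
    exact Set.finite_of_ncard_ne_zero (by rw [lin_inter_trg_segment_ncard]; norm_num)
  omega

/-- **The two tables at `10⁻²`**: every closed sub-interval of `[81/64, 2855/2048]` of length `≥ 1/100` holds at
least `1062 = 783 + 295 − 16` distinct values of `linFamily 12 ∪ trgFullFamily 17 32` — at the widths at which §7 reads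
the census a certified `Δε`-interval anywhere in the segment contains OVER A THOUSAND members of the two transcendental
tables alone (kernel, worst case; the rational and algebraic tables add more), which is why membership carries no
evidential weight there (§1.6). [folklore] -/
theorem realTables_centi_interval_ncard {a b : ℝ} (ha : (81 / 64 : ℝ) ≤ a) (hb : b ≤ 2855 / 2048)
    (hab : (1 / 100 : ℝ) ≤ b - a) : 1062 ≤ ((linFamily 12 ∪ trgFullFamily 17 32) ∩ Set.Icc a b).ncard := by
  have h1 := lin_centi_interval_ncard ha hb hab
  have h2 := trg_centi_interval_ncard ha hb hab
  have h3 := realTables_interval_ncard_ge ha hb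
  omega

/-- **The two tables at `10⁻³`**: every closed sub-interval of the segment of length `≥ 1/1000` holds at least
`91 = 78 + 29 − 16` distinct values of the two tables. [folklore] -/
theorem realTables_milli_interval_ncard {a b : ℝ} (ha : (81 / 64 : ℝ) ≤ a) (hb : b ≤ 2855 / 2048)
    (hab : (1 / 1000 : ℝ) ≤ b - a) : 91 ≤ ((linFamily 12 ∪ trgFullFamily 17 32) ∩ Set.Icc a b).ncard := by
  have h1 := lin_milli_interval_ncard ha hb hab
  have h2 := trg_milli_interval_ncard ha hb hab
  have h3 := realTables_interval_ncard_ge ha hb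
  omega

/-- **Both sides in one conjunction (the §1.6 sentence as a kernel fact).** On the certified `Δε`-segment: every
closed sub-interval of length `≥ 10⁻²` holds `≥ 1062` values of the two transcendental tables and every one of length
`≥ 10⁻³` holds `≥ 91`, while every one of length `< 43966·10⁻¹⁶` holds at most one, and one of length
`≤ 45983·10⁻¹⁶` holds two. [folklore] -/
theorem recognition_illposed_at_census_widths :
    (∀ a b : ℝ, (81 / 64 : ℝ) ≤ a → b ≤ 2855 / 2048 → (1 / 100 : ℝ) ≤ b - a →
        1062 ≤ ((linFamily 12 ∪ trgFullFamily 17 32) ∩ Set.Icc a b).ncard) ∧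
      (∀ a b : ℝ, (81 / 64 : ℝ) ≤ a → b ≤ 2855 / 2048 → (1 / 1000 : ℝ) ≤ b - a →
        91 ≤ ((linFamily 12 ∪ trgFullFamily 17 32) ∩ Set.Icc a b).ncard) ∧
      (∀ a b : ℝ, (81 / 64 : ℝ) ≤ a → b ≤ 2855 / 2048 → b - a < (43966 : ℝ) / 10 ^ 16 →
        ((linFamily 12 ∪ trgFullFamily 17 32) ∩ Set.Icc a b).ncard ≤ 1) ∧
      (∃ a b : ℝ, (81 / 64 : ℝ) ≤ a ∧ b ≤ 2855 / 2048 ∧ b - a ≤ (45983 : ℝ) / 10 ^ 16 ∧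
        2 ≤ ((linFamily 12 ∪ trgFullFamily 17 32) ∩ Set.Icc a b).ncard) :=
  ⟨fun _ _ ha hb hab => realTables_centi_interval_ncard ha hb hab,
    fun _ _ ha hb hab => realTables_milli_interval_ncard ha hb hab, recognition_width.1, recognition_width.2⟩

end ColumnFaceL11
end Summit.CriticalPhenomena.Ising3D
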